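import Literature.NumberTheory.Sieve.ChenSwitchedCount
import Literature.NumberTheory.Sieve.ChenTheoremISwitchedSieve
import Literature.NumberTheory.Sieve.ChenSwitchingConstantTenth
import HarnessLib

/-!
# Chen's Theorem I: the cardinality of the enlarged switched set at Chen's level `z = x^{1/10}`

Sequel of `ChenTheoremISwitchedSieve.lean` (the sieve step of the bound for the switched count
`S(B, 𝒫, y)`, `B = {N − p₁p₂p₃ : N^{1/10} ≤ p₁ < N^{1/3} ≤ p₂ ≤ p₃}`, hypothesis (C) of
`Literature.NumberTheory.Sieve.Chen.Chen1973_theoremI_of`). This file proves the third of the three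
steps, the count of the enlarged index set `T̃(N, ε)` (`switchedTriplesT`):

  `#T̃(N, ε) ≤ (1 + ε)² (c₁₀ + η) N/log N`  for all large `N`, every `0 < ε ≤ 1`, `η > 0`
  (`card_switchedTriplesT_le`), `c₁₀ = ∫_{1/10}^{1/3} log(2 − 3β)/(β(1 − β)) dβ = switchingConstantTenth`

— Chen's Lemma 8 computation `∑_{x^{1/10} < p₁ ≤ x^{1/3} < p₂ ≤ (x/p₁)^{1/2}} 1/(p₁p₂ log(x/p₁p₂)) ≤
(1 + o(1)) c₁₀/log x` ((27)–(28), PDF pp. 166–167 of the held copy), done exactly as the tree's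
`ChenSwitchedCount.lean` does Nathanson's count for `p₁ ≥ N^{1/8}` (pp. 289–290): the prime number
theorem counts `p₃`, the sums over `p₂` and `p₁` against `1/p` are compared with the integrals through
Mertens' second theorem on windows of a logarithmic grid (the generic tools `inner_sum_le`,
`sum_primeWindow_grid_le`, `phiFun` of that file are reused; `outer_sum_leT` is the outer comparison
with the integral started at `1/10`). The definitions of `ChenSwitchedCount` (`phiFun`, `primeWindow`,
`secondPrimes`) are reused; the range of `p₁` is `midPrimes (N^{1/10}) (N^{1/3})` of `ChenTheorem`.
No named facts; everything is proved.

## References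

* Chen Jing-run, Sci. Sinica 16 (1973) 157–176, Lemma 8, (27)–(28) (PDF pp. 166–167 of the held copy).
  [ChenSciSinica1973]
* M. B. Nathanson, *Additive Number Theory: The Classical Bases*, GTM 164 (1996), Thm 10.6 (proof),
  pp. 289–290. [Nathanson1996]
-/

open Finset Filter Topology

noncomputable section

namespace Literature.NumberTheory.Sieve.Chen

open Literature.NumberTheory.LFunctions.Mertens

/-! ### The integral from `1/10` and the outer comparison -/

/-- `∫_{1/10}^{1/3} Φ(s)/s ds = c₁₀ = switchingConstantTenth`. [cite: ChenSciSinica1973, Lemma 8 eq. (28)] -/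
theorem integral_phiFun_div_tenth :
    ∫ s in (1 / 10 : ℝ)..(1 / 3), phiFun s / s = switchingConstantTenth := by
  rw [switchingConstantTenth]
  exact intervalIntegral.integral_congr fun s _ => phiFun_div_eq s

/-- `0 ≤ c₁₀`. [folklore] -/
theorem switchingConstantTenth_nonneg : 0 ≤ switchingConstantTenth := by
  rw [← integral_phiFun_div_tenth]
  refine intervalIntegral.integral_nonneg (by norm_num) fun s hs => ?_
  exact div_nonneg (phiFun_nonneg hs.2) (by linarith [hs.1])

/-- Membership in the `p₁`-range `midPrimes (N^{1/10}) y`. [folklore] -/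
theorem mem_midPrimes_tenth {N p : ℕ} :
    p ∈ midPrimes ((N : ℝ) ^ (1 / 10 : ℝ)) (y N) ↔
      p.Prime ∧ (N : ℝ) ^ (1 / 10 : ℝ) ≤ (p : ℝ) ∧ (p : ℝ) < y N := by
  rw [midPrimes, Finset.mem_filter, Nat.mem_primesBelow, Nat.lt_ceil]
  tauto

set_option maxHeartbeats 400000 in
/-- **The outer prime sum against `Φ(log p/log X)/p`, window started near `1/10`** (as
`outer_sum_le`, with the integral `∫_{1/10}^{1/3} Φ(s)/s ds = c₁₀`): for `X > 1`, `2/25 ≤ s₀ ≤ 1/10 ≤ s_M ≤ 1/3`,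
`m ≥ 1`, `X^{s₀} ≥ 2`,
`∑_{X^{s₀} < p ≤ X^{s_M}} (1/p) Φ(log p/log X) ≤ c₁₀ + 25(1/10 − s₀) + 25/m + 400 m/log X`.
[cite: ChenSciSinica1973, Lemma 8 eq. (28)] -/
theorem outer_sum_leT {X s₀ sM : ℝ} (hX : 1 < X) (hs₀ : 2 / 25 ≤ s₀) (hs₀' : s₀ ≤ 1 / 10)
    (hsM : 1 / 10 ≤ sM) (hsM' : sM ≤ 1 / 3) {m : ℕ} (hm : 1 ≤ m) (hx2 : 2 ≤ X ^ s₀) :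
    ∑ p ∈ primeWindow (X ^ s₀) (X ^ sM), (p : ℝ)⁻¹ * phiFun (Real.log p / Real.log X) ≤
      switchingConstantTenth + 25 * (1 / 10 - s₀) + 25 / m + 400 * m / Real.log X := by
  have hX0 : 0 < X := by linarith
  have hL : 0 < Real.log X := Real.log_pos hX
  have hm0 : (0 : ℝ) < m := by exact_mod_cast hm
  have hs₀0 : 0 < s₀ := by linarith
  have hc0 : 0 ≤ switchingConstantTenth := switchingConstantTenth_nonneg
  have hRHS0 : 0 ≤ switchingConstantTenth + 25 * (1 / 10 - s₀) + 25 / m + 400 * m / Real.log X := by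
    have : 0 ≤ 1 / 10 - s₀ := by linarith
    positivity
  -- the degenerate case `sM = s₀`
  rcases eq_or_lt_of_le (show s₀ ≤ sM by linarith) with heq | hlt
  · rw [← heq]
    have : primeWindow (X ^ s₀) (X ^ s₀) = ∅ := by simp [primeWindow]
    rw [this, Finset.sum_empty]
    exact hRHS0
  -- the grid
  set Δ : ℝ := (sM - s₀) / m with hΔ
  have hΔ0 : 0 < Δ := div_pos (by linarith) hm0
  have hmΔ : s₀ + m * Δ = sM := by rw [hΔ]; field_simp; ring
  have hΔm : Δ * m = sM - s₀ := by rw [hΔ]; field_simp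
  have hΔle : Δ ≤ 1 / m := by
    rw [hΔ, div_le_div_iff_of_pos_right hm0]; linarith
  have hsi_le : ∀ i : ℕ, i ≤ m → s₀ + i * Δ ≤ sM := fun i hi => by
    have : (i : ℝ) ≤ m := by exact_mod_cast hi
    nlinarith
  set f : ℝ → ℝ := fun s => phiFun s / s with hf
  set g : ℕ → ℝ := fun i => phiFun (min (s₀ + i * Δ) (1 / 3)) with hg
  have hg0 : ∀ i, 0 ≤ g i := fun i => phiFun_nonneg (min_le_right _ _)
  have hg_eq : ∀ i, i ≤ m → g i = phiFun (s₀ + i * Δ) := fun i hi => by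
    simp only [hg]; rw [min_eq_left ((hsi_le i hi).trans hsM')]
  -- the weight inequality on each window
  have hw : ∀ i, i < m → ∀ p ∈ primeWindow (X ^ (s₀ + i * Δ)) (X ^ (s₀ + (i + 1) * Δ)),
      (p : ℝ)⁻¹ * phiFun (Real.log p / Real.log X) ≤ g i * (p : ℝ)⁻¹ := by
    intro i hi p hp
    have hx1 : 0 ≤ X ^ (s₀ + i * Δ) := Real.rpow_nonneg hX0.le _
    obtain ⟨hprime, hlo, hhi⟩ := (mem_primeWindow hx1).mp hp
    have hp0 : (0 : ℝ) < p := by exact_mod_cast hprime.pos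
    have hsi0 : 0 ≤ s₀ + i * Δ := by positivity
    -- `s_i ≤ u_p ≤ s_{i+1} ≤ 1/3`
    have hu_lo : s₀ + i * Δ ≤ Real.log p / Real.log X := by
      rw [le_div_iff₀ hL]
      have := Real.log_le_log (Real.rpow_pos_of_pos hX0 _) hlo.le
      rw [Real.log_rpow hX0] at this
      linarith
    have hu_hi : Real.log p / Real.log X ≤ 1 / 3 := by
      rw [div_le_iff₀ hL]
      have := Real.log_le_log hp0 hhi
      rw [Real.log_rpow hX0] at this
      have h2 := hsi_le (i + 1) (by omega)
      push_cast at h2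
      nlinarith
    rw [mul_comm, hg_eq i hi.le]
    refine mul_le_mul_of_nonneg_right ?_ (by positivity)
    exact phiFun_antitoneOn ⟨hsi0, (hsi_le i hi.le).trans hsM'⟩ ⟨by linarith, hu_hi⟩ hu_lo
  have htool := sum_primeWindow_grid_le hX hs₀0 hΔ0 m hx2 _ g hg0 hw
  rw [hmΔ] at htool
  refine htool.trans ?_
  -- bound each grid term: `g_i Δ/s_i = Δ f(s_i)`, `g_i 16/(s_i L) ≤ 400/L`
  have hterm : ∀ i ∈ Finset.range m,
      g i * (Δ / (s₀ + i * Δ) + 16 / ((s₀ + i * Δ) * Real.log X)) ≤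
        Δ * f (s₀ + i * Δ) + 400 / Real.log X := by
    intro i hi
    have hi' : i < m := Finset.mem_range.mp hi
    have hsipos : 0 < s₀ + i * Δ := by positivity
    have hsi3 : s₀ + i * Δ ≤ 1 / 3 := (hsi_le i hi'.le).trans hsM'
    rw [hg_eq i hi'.le, mul_add]
    refine add_le_add (le_of_eq ?_) ?_
    · simp only [hf]; field_simp
    · have hΦ2 : phiFun (s₀ + i * Δ) ≤ 2 := phiFun_le_two hsipos.le hsi3
      have hΦ0 : 0 ≤ phiFun (s₀ + i * Δ) := phiFun_nonneg hsi3
      have hinv : 16 / ((s₀ + i * Δ) * Real.log X) ≤ 200 / Real.log X := by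
        rw [div_le_div_iff₀ (by positivity) hL]
        have hq : 2 / 25 ≤ s₀ + i * Δ := le_trans hs₀ (le_add_of_nonneg_right (by positivity))
        have := mul_le_mul_of_nonneg_right hq hL.le
        nlinarith
      calc phiFun (s₀ + i * Δ) * (16 / ((s₀ + i * Δ) * Real.log X)) ≤ 2 * (200 / Real.log X) :=
            mul_le_mul hΦ2 hinv (by positivity) (by norm_num)
        _ = 400 / Real.log X := by ring
  refine (Finset.sum_le_sum hterm).trans ?_
  rw [Finset.sum_add_distrib, Finset.sum_const, Finset.card_range, nsmul_eq_mul]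
  -- the left Riemann sum of the antitone `f`
  have hfanti : AntitoneOn f (Set.Icc s₀ sM) := phiFun_div_antitoneOn hs₀0 hsM'
  have hfle : ∀ s ∈ Set.Icc s₀ sM, f s ≤ 25 := fun s hs => by
    have hs0 : 0 < s := lt_of_lt_of_le hs₀0 hs.1
    simp only [hf]
    rw [div_le_iff₀ hs0]
    have := phiFun_le_two hs0.le (hs.2.trans hsM')
    nlinarith [hs.1]
  have hf0 : ∀ s ∈ Set.Icc s₀ sM, 0 ≤ f s := fun s hs => by
    simp only [hf]
    exact div_nonneg (phiFun_nonneg (hs.2.trans hsM')) (by linarith [hs.1])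
  have hfint : IntervalIntegrable f MeasureTheory.volume s₀ sM :=
    ((continuousOn_phiFun_div hs₀0 hsM').mono
      (Set.uIcc_of_le hlt.le ▸ le_rfl : Set.uIcc s₀ sM ⊆ Set.Icc s₀ sM)).intervalIntegrable
  -- `∑_{i<m} Δ f(s_i) = Δ f(s₀) + ∑_{i<m-1} Δ f(s_{i+1}) ≤ Δ f(s₀) + ∫_{s₀}^{sM} f`
  obtain ⟨m', rfl⟩ : ∃ m', m = m' + 1 := ⟨m - 1, by omega⟩
  have hsum_eq : ∑ i ∈ Finset.range (m' + 1), Δ * f (s₀ + i * Δ) =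
      (∑ i ∈ Finset.range m', Δ * f (s₀ + (i + 1) * Δ)) + Δ * f s₀ := by
    rw [Finset.sum_range_succ']
    push_cast
    simp only [zero_mul, add_zero]
  have hRS : ∑ i ∈ Finset.range m', Δ * f (s₀ + (i + 1) * Δ) ≤ ∫ s in s₀..sM, f s := by
    have hm'Δ : s₀ + m' * Δ ≤ sM := by
      have := hsi_le m' (by omega); exact this
    have hanti' : AntitoneOn f (Set.Icc s₀ (s₀ + m' * Δ)) :=
      hfanti.mono fun s hs => ⟨hs.1, hs.2.trans hm'Δ⟩
    refine (sum_mul_le_integral_of_antitoneOn hΔ0 m' hanti').trans ?_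
    refine intervalIntegral.integral_mono_interval le_rfl (by nlinarith) hm'Δ ?_ hfint
    rw [Filter.EventuallyLE, MeasureTheory.ae_restrict_iff' measurableSet_Ioc]
    exact Filter.Eventually.of_forall fun s hs => hf0 s ⟨hs.1.le, hs.2⟩
  -- `∫_{s₀}^{sM} f ≤ 25 (1/10 - s₀) + c₁₀`
  have hint_le : ∫ s in s₀..sM, f s ≤ 25 * (1 / 10 - s₀) + switchingConstantTenth := by
    have hint1 : IntervalIntegrable f MeasureTheory.volume s₀ (1 / 10) :=
      hfint.mono_set (by rw [Set.uIcc_of_le hs₀', Set.uIcc_of_le hlt.le]; exact Set.Icc_subset_Icc le_rfl hsM)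
    have hint2 : IntervalIntegrable f MeasureTheory.volume (1 / 10) sM :=
      hfint.mono_set (by rw [Set.uIcc_of_le hsM, Set.uIcc_of_le hlt.le]; exact Set.Icc_subset_Icc hs₀' le_rfl)
    have hint3 : IntervalIntegrable f MeasureTheory.volume (1 / 10) (1 / 3) :=
      ((continuousOn_phiFun_div (by norm_num : (0 : ℝ) < 1 / 10) le_rfl).mono
        (Set.uIcc_of_le (by norm_num : (1 : ℝ) / 10 ≤ 1 / 3) ▸ le_rfl :
          Set.uIcc (1 / 10 : ℝ) (1 / 3) ⊆ Set.Icc (1 / 10) (1 / 3))).intervalIntegrable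
    rw [← intervalIntegral.integral_add_adjacent_intervals hint1 hint2]
    have h1 : ∫ s in s₀..(1 / 10 : ℝ), f s ≤ 25 * (1 / 10 - s₀) := by
      calc ∫ s in s₀..(1 / 10 : ℝ), f s ≤ ∫ _ in s₀..(1 / 10 : ℝ), (25 : ℝ) :=
            intervalIntegral.integral_mono_on hs₀' hint1 (by simp) fun s hs => hfle s ⟨hs.1, hs.2.trans hsM⟩
        _ = 25 * (1 / 10 - s₀) := by rw [intervalIntegral.integral_const, smul_eq_mul]; ring
    have h2 : ∫ s in (1 / 10 : ℝ)..sM, f s ≤ switchingConstantTenth := by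
      rw [← integral_phiFun_div_tenth]
      refine intervalIntegral.integral_mono_interval le_rfl hsM hsM' ?_ hint3
      rw [Filter.EventuallyLE, MeasureTheory.ae_restrict_iff' measurableSet_Ioc]
      refine Filter.Eventually.of_forall fun s hs => ?_
      simp only [hf, Pi.zero_apply]
      exact div_nonneg (phiFun_nonneg hs.2) (by linarith [hs.1])
    linarith
  have hfirst : Δ * f s₀ ≤ 25 / (m' + 1 : ℕ) := by
    have hf20 : f s₀ ≤ 25 := hfle s₀ ⟨le_rfl, hlt.le⟩
    have hf0' : 0 ≤ f s₀ := hf0 s₀ ⟨le_rfl, hlt.le⟩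
    calc Δ * f s₀ ≤ (1 / (m' + 1 : ℕ)) * 25 := mul_le_mul hΔle hf20 hf0' (by positivity)
      _ = 25 / (m' + 1 : ℕ) := by ring
  rw [hsum_eq]
  have : ((m' + 1 : ℕ) : ℝ) * (400 / Real.log X) = 400 * ((m' + 1 : ℕ) : ℝ) / Real.log X := by ring
  rw [this]
  linarith [hRS, hint_le, hfirst]



/-! ### Assembling the count -/

/-- **`|B̃| ≤ ∑_{p₁} ∑_{p₂} π((1+ε)N/(p₁p₂))`** (Nathanson p. 289: a triple of `T̃(N, ε)` has
`p₁p₂p₃ < (1+ε)N`, hence `p₁p₂² < (1+ε)N` and `p₃ < (1+ε)N/(p₁p₂)`).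
[cite: Nathanson1996, Thm 10.6 (proof, (10.14) and p. 289)] -/
theorem card_switchedTriplesT_le_sum {N : ℕ} {ε : ℝ} (hN : 0 < N) (hε : 0 < ε) :
    (#(switchedTriplesT N ε) : ℝ) ≤
      ∑ p₁ ∈ midPrimes ((N : ℝ) ^ (1 / 10 : ℝ)) (y N), ∑ p₂ ∈ secondPrimes N ε p₁,
        (#(Nat.primesBelow ⌈(1 + ε) * N / (p₁ * p₂)⌉₊) : ℝ) := by
  classical
  set S : Finset (Σ _ : ℕ, Σ _ : ℕ, ℕ) := (midPrimes ((N : ℝ) ^ (1 / 10 : ℝ)) (y N)).sigma fun p₁ =>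
    (secondPrimes N ε p₁).sigma fun p₂ => Nat.primesBelow ⌈(1 + ε) * N / (p₁ * p₂)⌉₊ with hS
  have hcardS : (#S : ℝ) = ∑ p₁ ∈ midPrimes ((N : ℝ) ^ (1 / 10 : ℝ)) (y N), ∑ p₂ ∈ secondPrimes N ε p₁,
      (#(Nat.primesBelow ⌈(1 + ε) * N / (p₁ * p₂)⌉₊) : ℝ) := by
    rw [hS, Finset.card_sigma]
    push_cast
    refine Finset.sum_congr rfl fun p₁ _ => ?_
    rw [Finset.card_sigma]
    push_cast
    rfl
  rw [← hcardS]
  have hN0 : (0 : ℝ) < N := by exact_mod_cast hN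
  refine Nat.cast_le.mpr (Finset.card_le_card_of_injOn
    (fun t : ℕ × ℕ × ℕ => (⟨t.1, ⟨t.2.1, t.2.2⟩⟩ : Σ _ : ℕ, Σ _ : ℕ, ℕ)) (fun t ht => ?_) ?_)
  · rw [Finset.mem_coe] at ht
    obtain ⟨-, h₁, h₂, h₃, hz, hy, hy', h23, -, -, hlt⟩ := mem_switchedTriplesT.mp ht
    rw [Finset.mem_coe, hS, Finset.mem_sigma, Finset.mem_sigma, mem_midPrimes_tenth, mem_secondPrimes,
      Nat.mem_primesBelow, Nat.lt_ceil]
    dsimp only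
    -- `p₁p₂p₃ < (1+ε) N`
    have hℓ := chenGridPointT_pos hN hε t.1
    have hp1 : (t.1 : ℝ) < (1 + ε) * chenGridPointT N ε t.1 := lt_mul_chenGridPointT hN hε hz
    have h2pos : (0 : ℝ) < t.2.1 := by exact_mod_cast h₂.pos
    have h3pos : (0 : ℝ) < t.2.2 := by exact_mod_cast h₃.pos
    have h1pos : (0 : ℝ) < t.1 := by exact_mod_cast h₁.pos
    have hprod : (t.1 : ℝ) * t.2.1 * t.2.2 < (1 + ε) * N := by
      calc (t.1 : ℝ) * t.2.1 * t.2.2 = (t.1 : ℝ) * ((t.2.1 : ℝ) * t.2.2) := by ring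
        _ < (1 + ε) * chenGridPointT N ε t.1 * ((t.2.1 : ℝ) * t.2.2) := by gcongr
        _ = (1 + ε) * (chenGridPointT N ε t.1 * t.2.1 * t.2.2) := by ring
        _ < (1 + ε) * N := by gcongr
    have h23' : (t.2.1 : ℝ) ≤ t.2.2 := by exact_mod_cast h23
    refine ⟨⟨h₁, hz, hy⟩, ⟨h₂, hy', ?_⟩, ?_, h₃⟩
    · -- `p₂ < √((1+ε)N/p₁)`
      rw [Real.lt_sqrt h2pos.le, lt_div_iff₀ h1pos]
      calc (t.2.1 : ℝ) ^ 2 * t.1 = t.1 * t.2.1 * t.2.1 := by ring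
        _ ≤ t.1 * t.2.1 * t.2.2 := by gcongr
        _ < (1 + ε) * N := hprod
    · -- `p₃ < (1+ε)N/(p₁p₂)`
      rw [lt_div_iff₀ (by positivity)]
      linarith [hprod]
  · intro t _ t' _ h
    simp only [Sigma.mk.injEq, heq_eq_eq] at h
    obtain ⟨h1, h2, h3⟩ := h
    exact Prod.ext h1 (Prod.ext h2 h3)


/-- **The prime number theorem step** (Nathanson p. 289: `π((1+ε)N/(p₁p₂)) <
(1+2ε)N/(p₁p₂ log(N/p₁p₂))` for `N ≥ N(ε)`): if `#{p < x} ≤ (1+κ)x/log x` for all `x ≥ x₀` and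
`N^{1/3} ≥ x₀ ≥ 3`, then with `X' = (1+ε)N`, `L' = log X'`, `u_i = log p_i/L'`,
`#T̃(N, ε) ≤ (1+κ)(X'/L') ∑_{p₁} p₁⁻¹ ∑_{p₂} p₂⁻¹/(1 − u₁ − u₂)`
(`log(X'/(p₁p₂)) = L'(1 − u₁ − u₂) > 0` as `X'/(p₁p₂) > (X'/p₁)^{1/2} > N^{1/3}`).
[cite: Nathanson1996, Thm 10.6 (proof, p. 289)] -/
theorem card_le_pnt_sumT {N : ℕ} {ε κ x₀ : ℝ} (hN : 2 ≤ N) (hε : 0 < ε) (hx₀3 : 3 ≤ x₀)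
    (hPNT : ∀ x : ℝ, x₀ ≤ x → (#(Nat.primesBelow ⌈x⌉₊) : ℝ) ≤ (1 + κ) * x / Real.log x)
    (hNx₀ : x₀ ≤ (N : ℝ) ^ (1 / 3 : ℝ)) (hκ : 0 ≤ κ) :
    (#(switchedTriplesT N ε) : ℝ) ≤
      (1 + κ) * ((1 + ε) * N / Real.log ((1 + ε) * N)) *
        ∑ p₁ ∈ midPrimes ((N : ℝ) ^ (1 / 10 : ℝ)) (y N), (p₁ : ℝ)⁻¹ * ∑ p₂ ∈ secondPrimes N ε p₁,
          (p₂ : ℝ)⁻¹ * (1 / ((1 - Real.log p₁ / Real.log ((1 + ε) * N)) -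
            Real.log p₂ / Real.log ((1 + ε) * N))) := by
  have hNpos : 0 < N := by omega
  have hN0 : (0 : ℝ) < N := by exact_mod_cast hNpos
  have hN1 : (1 : ℝ) < N := by exact_mod_cast (show 1 < N by omega)
  set X' : ℝ := (1 + ε) * N with hX'
  have hX'N : (N : ℝ) ≤ X' := by rw [hX']; nlinarith
  have hX'0 : 0 < X' := by positivity
  have hX'1 : 1 < X' := by linarith
  set L' : ℝ := Real.log X' with hL'
  have hL'0 : 0 < L' := Real.log_pos hX'1
  refine (card_switchedTriplesT_le_sum hNpos hε).trans ?_
  rw [Finset.mul_sum]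
  refine Finset.sum_le_sum fun p₁ hp₁ => ?_
  rw [Finset.mul_sum, Finset.mul_sum]
  refine Finset.sum_le_sum fun p₂ hp₂ => ?_
  obtain ⟨hp₁prime, hz₁, hy₁⟩ := mem_midPrimes_tenth.mp hp₁
  obtain ⟨hp₂prime, hy₂, hsq₂⟩ := mem_secondPrimes.mp hp₂
  have hp₁0 : (0 : ℝ) < p₁ := by exact_mod_cast hp₁prime.pos
  have hp₂0 : (0 : ℝ) < p₂ := by exact_mod_cast hp₂prime.pos
  have hy0 : 0 < y N := Real.rpow_pos_of_pos hN0 _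
  -- `x = X'/(p₁p₂) ≥ N^{1/3} ≥ x₀`
  set x : ℝ := X' / (p₁ * p₂) with hxdef
  have hx0 : 0 < x := by positivity
  have hxsq : Real.sqrt (X' / p₁) < x := by
    -- `p₁ p₂ < p₁ √(X'/p₁) = √(p₁ X')`, so `x > X'/√(p₁X') = √(X'/p₁)`
    rw [hxdef, lt_div_iff₀ (by positivity)]
    have h1 : Real.sqrt (X' / p₁) * (p₁ * p₂) < Real.sqrt (X' / p₁) * (p₁ * Real.sqrt (X' / p₁)) := by
      gcongr
    have h2 : Real.sqrt (X' / p₁) * (p₁ * Real.sqrt (X' / p₁)) = X' := by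
      have := Real.mul_self_sqrt (show 0 ≤ X' / p₁ by positivity)
      calc Real.sqrt (X' / p₁) * (p₁ * Real.sqrt (X' / p₁)) = p₁ * (Real.sqrt (X' / p₁) * Real.sqrt (X' / p₁)) := by ring
        _ = p₁ * (X' / p₁) := by rw [this]
        _ = X' := by field_simp
    linarith
  have hxy : y N ≤ Real.sqrt (X' / p₁) := by
    -- `y² = N^{2/3} ≤ N/p₁ ≤ X'/p₁` as `p₁ < y = N^{1/3}`
    rw [Real.le_sqrt' hy0, le_div_iff₀ hp₁0]
    have hy3 : y N ^ 2 * y N = (N : ℝ) := by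
      rw [y, ← Real.rpow_natCast, ← Real.rpow_mul hN0.le, ← Real.rpow_add hN0]
      norm_num
    have hyp : y N ^ 2 * (p₁ : ℝ) ≤ y N ^ 2 * y N :=
      mul_le_mul_of_nonneg_left hy₁.le (by positivity)
    calc y N ^ 2 * (p₁ : ℝ) ≤ y N ^ 2 * y N := hyp
      _ = (N : ℝ) := hy3
      _ ≤ X' := hX'N
  have hxx₀ : x₀ ≤ x := by linarith [hNx₀.trans hxy]
  have hx1 : 1 < x := by linarith
  -- the logarithm
  have hlogx : Real.log x = L' * ((1 - Real.log p₁ / L') - Real.log p₂ / L') := by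
    rw [hxdef, Real.log_div hX'0.ne' (by positivity), Real.log_mul hp₁0.ne' hp₂0.ne']
    field_simp
    ring
  have hlogx0 : 0 < Real.log x := Real.log_pos hx1
  have hden : 0 < (1 - Real.log p₁ / L') - Real.log p₂ / L' := by
    have := hlogx0; rw [hlogx] at this
    exact pos_of_mul_pos_right this hL'0.le |> fun h => by
      rcases lt_trichotomy ((1 - Real.log p₁ / L') - Real.log p₂ / L') 0 with h' | h' | h'
      · nlinarith
      · rw [h', mul_zero] at this; exact absurd this (lt_irrefl 0)
      · exact h'
  -- PNT
  have hpnt := hPNT x hxx₀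
  refine hpnt.trans (le_of_eq ?_)
  rw [hlogx, hxdef]
  field_simp


set_option maxHeartbeats 800000 in
/-- **The inner sum for `p₁ ∈ [N^{1/10}, y)`**: for `N ≥ 6^{10}`, `log N ≥ 15`, `0 < ε ≤ 1`, `m ≥ 1`, with
`X' = (1+ε)N`, `L' = log X'`, `u₁ = log p₁/L'`,
`∑_{p₂} p₂⁻¹/(1 − u₁ − u₂) ≤ Φ(u₁) + 8/m + 272 m/L'` (for `p₁ ≥ N^{1/10}`; the sum over `y ≤ p₂ < (X'/p₁)^{1/2}`
sits inside the window `(y/e, X'^{(1−u₁)/2}]`, to which `inner_sum_le` applies with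
`t₀ = (log y − 1)/L' ∈ [1/4, 1/3]`). [cite: Nathanson1996, Thm 10.6 (proof, pp. 289–290)] -/
theorem inner_appliedT {N : ℕ} {ε : ℝ} (hN : 6 ^ 10 ≤ N) (hε : 0 < ε) (hε1 : ε ≤ 1)
    (hL : 15 ≤ Real.log N) {m : ℕ} (hm : 1 ≤ m) {p₁ : ℕ} (hp₁ : p₁ ∈ midPrimes ((N : ℝ) ^ (1 / 10 : ℝ)) (y N)) :
    ∑ p₂ ∈ secondPrimes N ε p₁, (p₂ : ℝ)⁻¹ *
        (1 / ((1 - Real.log p₁ / Real.log ((1 + ε) * N)) - Real.log p₂ / Real.log ((1 + ε) * N))) ≤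
      phiFun (Real.log p₁ / Real.log ((1 + ε) * N)) + 8 / m + 272 * m / Real.log ((1 + ε) * N) := by
  have hN2 : 2 ≤ N := le_trans (by norm_num) hN
  have hN0 : (0 : ℝ) < N := by exact_mod_cast (show 0 < N by omega)
  have hN1 : (1 : ℝ) < N := by exact_mod_cast (show 1 < N by omega)
  obtain ⟨hX'1, hLL', hL'L⟩ := log_enlarged_bounds hN2 hε hε1
  set X' : ℝ := (1 + ε) * N with hX'
  set L' : ℝ := Real.log X' with hL'def
  set L : ℝ := Real.log N with hLdef
  have hX'0 : 0 < X' := by linarith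
  have hL'0 : 0 < L' := by linarith
  have hm0 : (0 : ℝ) < m := by exact_mod_cast hm
  obtain ⟨hp₁prime, hz₁, hy₁⟩ := mem_midPrimes_tenth.mp hp₁
  have hp₁0 : (0 : ℝ) < p₁ := by exact_mod_cast hp₁prime.pos
  have hz6 : (6 : ℝ) ≤ (N : ℝ) ^ (1 / 10 : ℝ) := by
    rw [show (6 : ℝ) = ((6 : ℝ) ^ (10 : ℕ)) ^ (1 / 10 : ℝ) by
      rw [← Real.rpow_natCast, ← Real.rpow_mul (by norm_num)]; norm_num]
    exact Real.rpow_le_rpow (by norm_num) (by exact_mod_cast hN) (by norm_num)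
  have hlogy : Real.log (y N) = L / 3 := by rw [y, Real.log_rpow hN0]; ring
  have hy0 : 0 < y N := Real.rpow_pos_of_pos hN0 _
  -- `u₁ ∈ (0, 1/3)`
  set u₁ : ℝ := Real.log p₁ / L' with hu₁
  have hlogp₁ : 0 < Real.log p₁ := Real.log_pos (by linarith)
  have hlogp₁y : Real.log p₁ < L / 3 := by rw [← hlogy]; exact Real.log_lt_log hp₁0 hy₁
  have hu₁0 : 0 < u₁ := div_pos hlogp₁ hL'0
  have hu₁3 : u₁ < 1 / 3 := by
    rw [hu₁, div_lt_iff₀ hL'0]; linarith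
  set c : ℝ := 1 - u₁ with hc
  have hc23 : 2 / 3 ≤ c := by linarith
  have hc1 : c < 1 := by linarith
  set t₀ : ℝ := (Real.log (y N) - 1) / L' with ht₀
  have ht₀3 : t₀ ≤ 1 / 3 := by rw [ht₀, div_le_iff₀ hL'0, hlogy]; linarith
  have ht₀4 : 1 / 4 ≤ t₀ := by rw [ht₀, le_div_iff₀ hL'0, hlogy]; linarith
  -- the window endpoints
  have hrpow : ∀ s : ℝ, X' ^ s = Real.exp (L' * s) := fun s => by
    rw [Real.rpow_def_of_pos hX'0]
  have hwin0 : X' ^ t₀ = y N / Real.exp 1 := by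
    rw [hrpow, ht₀, mul_div_cancel₀ _ hL'0.ne', Real.exp_sub, Real.exp_log hy0]
  have hwin1 : X' ^ (c / 2) = Real.sqrt (X' / p₁) := by
    rw [hrpow, Real.sqrt_eq_rpow, Real.rpow_def_of_pos (by positivity), Real.log_div hX'0.ne' hp₁0.ne',
      hc, hu₁]
    congr 1
    field_simp
    ring
  have hx2 : 2 ≤ X' ^ t₀ := by
    rw [hwin0, le_div_iff₀ (Real.exp_pos 1)]
    have he := Real.exp_one_lt_d9
    have : (N : ℝ) ^ (1 / 10 : ℝ) ≤ y N := Real.rpow_le_rpow_of_exponent_le hN1.le (by norm_num)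
    nlinarith
  -- the sum over `secondPrimes` is a sub-sum over the window
  have hsub : secondPrimes N ε p₁ ⊆ primeWindow (X' ^ t₀) (X' ^ (c / 2)) := by
    intro p hp
    obtain ⟨hpprime, hyp, hsqp⟩ := mem_secondPrimes.mp hp
    rw [mem_primeWindow (Real.rpow_nonneg hX'0.le _), hwin0, hwin1]
    refine ⟨hpprime, ?_, hsqp.le⟩
    have he : 1 < Real.exp 1 := by have := Real.exp_one_gt_d9; linarith
    have : y N / Real.exp 1 < y N := div_lt_self hy0 he
    linarith
  have hnonneg : ∀ p ∈ primeWindow (X' ^ t₀) (X' ^ (c / 2)),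
      0 ≤ (p : ℝ)⁻¹ * (1 / (c - Real.log p / L')) := by
    intro p hp
    obtain ⟨hpprime, -, hhi⟩ := (mem_primeWindow (Real.rpow_nonneg hX'0.le _)).mp hp
    have hp0 : (0 : ℝ) < p := by exact_mod_cast hpprime.pos
    have hu : Real.log p / L' ≤ c / 2 := by
      rw [div_le_iff₀ hL'0]
      have := Real.log_le_log hp0 hhi
      rw [Real.log_rpow hX'0] at this
      linarith
    have : 0 < c - Real.log p / L' := by linarith
    positivity
  have hstep : ∑ p₂ ∈ secondPrimes N ε p₁, (p₂ : ℝ)⁻¹ * (1 / (c - Real.log p₂ / L')) ≤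
      ∑ p₂ ∈ primeWindow (X' ^ t₀) (X' ^ (c / 2)), (p₂ : ℝ)⁻¹ * (1 / (c - Real.log p₂ / L')) :=
    Finset.sum_le_sum_of_subset_of_nonneg hsub fun p hp _ => hnonneg p hp
  refine hstep.trans ?_
  refine (inner_sum_le hX'1 hc23 hc1 ht₀4 ht₀3 hm hx2).trans ?_
  -- numerical cleanup
  have hΦ : phiFun (1 - c) = phiFun u₁ := by rw [hc, sub_sub_cancel]
  rw [hΦ]
  have hΦ2 : phiFun u₁ ≤ 2 := phiFun_le_two hu₁0.le hu₁3.le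
  have hΦ0 : 0 ≤ phiFun u₁ := phiFun_nonneg hu₁3.le
  have ht₀' : 12 * (1 / 3 - t₀) ≤ 16 / L' := by
    rw [ht₀, hlogy]
    rw [show (1 : ℝ) / 3 - (L / 3 - 1) / L' = (L' / 3 - (L / 3 - 1)) / L' by field_simp]
    rw [mul_div_assoc', div_le_div_iff_of_pos_right hL'0]
    linarith
  have hm1 : (1 : ℝ) ≤ m := by exact_mod_cast hm
  have e1 : (1 + 4 / (m : ℝ)) * (phiFun u₁ + 12 * (1 / 3 - t₀)) ≤
      phiFun u₁ + 8 / m + 80 / L' := by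
    have h4m : 0 ≤ 4 / (m : ℝ) := by positivity
    have h4m1 : 4 / (m : ℝ) ≤ 4 := by rw [div_le_iff₀ hm0]; linarith
    have h12 : 0 ≤ 12 * (1 / 3 - t₀) := by linarith
    calc (1 + 4 / (m : ℝ)) * (phiFun u₁ + 12 * (1 / 3 - t₀))
        = phiFun u₁ + 4 / m * phiFun u₁ + (1 + 4 / m) * (12 * (1 / 3 - t₀)) := by ring
      _ ≤ phiFun u₁ + 4 / m * 2 + (1 + 4) * (16 / L') := by
          gcongr
      _ = phiFun u₁ + 8 / m + 80 / L' := by ring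
  have e2 : 80 / L' + 192 * m / L' ≤ 272 * m / L' := by
    rw [← add_div, div_le_div_iff_of_pos_right hL'0]; linarith
  linarith

set_option maxHeartbeats 800000 in
/-- **The outer sum over `p₁ ∈ [N^{1/10}, y)`**: for `N ≥ 6^{10}`, `log N ≥ 180`, `0 < ε ≤ 1`, `m ≥ 1`, `ρ ≥ 0`,
`∑_{z ≤ p₁ < y} p₁⁻¹ (Φ(u₁) + ρ) ≤ c₁₀ + 50/L' + 25/m + 400 m/L' + 3ρ` (`z = N^{1/10}`; the range sits inside the
window `(z/e, y] = (X'^{s₀}, X'^{s_M}]` with `s₀ = (log z − 1)/L' ∈ [2/25, 1/10]`, `s_M = log y/L' ∈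
[1/10, 1/3]`; `outer_sum_leT`, and `∑_{z/e < p ≤ y} 1/p ≤ 3` by Mertens).
[cite: ChenSciSinica1973, Lemma 8 eq. (28)] -/
theorem outer_appliedT {N : ℕ} {ε : ℝ} (hN : 6 ^ 10 ≤ N) (hε : 0 < ε) (hε1 : ε ≤ 1)
    (hL : 180 ≤ Real.log N) {m : ℕ} (hm : 1 ≤ m) {ρ : ℝ} (hρ : 0 ≤ ρ) :
    ∑ p₁ ∈ midPrimes ((N : ℝ) ^ (1 / 10 : ℝ)) (y N),
        (p₁ : ℝ)⁻¹ * (phiFun (Real.log p₁ / Real.log ((1 + ε) * N)) + ρ) ≤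
      switchingConstantTenth + 50 / Real.log ((1 + ε) * N) + 25 / m +
        400 * m / Real.log ((1 + ε) * N) + 3 * ρ := by
  have hN2 : 2 ≤ N := le_trans (by norm_num) hN
  have hN0 : (0 : ℝ) < N := by exact_mod_cast (show 0 < N by omega)
  have hN1 : (1 : ℝ) < N := by exact_mod_cast (show 1 < N by omega)
  obtain ⟨hX'1, hLL', hL'L⟩ := log_enlarged_bounds hN2 hε hε1
  set X' : ℝ := (1 + ε) * N with hX'
  set L' : ℝ := Real.log X' with hL'def
  set L : ℝ := Real.log N with hLdef
  have hX'0 : 0 < X' := by linarith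
  have hL'0 : 0 < L' := by linarith
  have hm0 : (0 : ℝ) < m := by exact_mod_cast hm
  set zT : ℝ := (N : ℝ) ^ (1 / 10 : ℝ) with hzT
  have hz6 : (6 : ℝ) ≤ zT := by
    rw [hzT, show (6 : ℝ) = ((6 : ℝ) ^ (10 : ℕ)) ^ (1 / 10 : ℝ) by
      rw [← Real.rpow_natCast, ← Real.rpow_mul (by norm_num)]; norm_num]
    exact Real.rpow_le_rpow (by norm_num) (by exact_mod_cast hN) (by norm_num)
  have hz0 : 0 < zT := by linarith
  have hlogz : Real.log zT = L / 10 := by rw [hzT, Real.log_rpow hN0]; ring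
  have hlogy : Real.log (y N) = L / 3 := by rw [y, Real.log_rpow hN0]; ring
  have hy0 : 0 < y N := Real.rpow_pos_of_pos hN0 _
  have hzy : zT ≤ y N := Real.rpow_le_rpow_of_exponent_le hN1.le (by norm_num)
  -- the exponents
  set s₀ : ℝ := (Real.log (zT) - 1) / L' with hs₀
  set sM : ℝ := Real.log (y N) / L' with hsM
  have hs₀8 : s₀ ≤ 1 / 10 := by rw [hs₀, div_le_iff₀ hL'0, hlogz]; linarith
  have hs₀10 : 2 / 25 ≤ s₀ := by rw [hs₀, le_div_iff₀ hL'0, hlogz]; linarith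
  have hsM3 : sM ≤ 1 / 3 := by rw [hsM, div_le_iff₀ hL'0, hlogy]; linarith
  have hsM8 : 1 / 10 ≤ sM := by rw [hsM, le_div_iff₀ hL'0, hlogy]; linarith
  have hrpow : ∀ s : ℝ, X' ^ s = Real.exp (L' * s) := fun s => by rw [Real.rpow_def_of_pos hX'0]
  have hwin0 : X' ^ s₀ = zT / Real.exp 1 := by
    rw [hrpow, hs₀, mul_div_cancel₀ _ hL'0.ne', Real.exp_sub, Real.exp_log hz0]
  have hwin1 : X' ^ sM = y N := by
    rw [hrpow, hsM, mul_div_cancel₀ _ hL'0.ne', Real.exp_log hy0]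
  have he1 : 1 < Real.exp 1 := by have := Real.exp_one_gt_d9; linarith
  have he3 : Real.exp 1 < 3 := by have := Real.exp_one_lt_d9; linarith
  have hx2 : 2 ≤ X' ^ s₀ := by
    rw [hwin0, le_div_iff₀ (Real.exp_pos 1)]; nlinarith
  -- `firstPrimes ⊆ (z/e, y]`
  have hsub : midPrimes zT (y N) ⊆ primeWindow (X' ^ s₀) (X' ^ sM) := by
    intro p hp
    obtain ⟨hpprime, hzp, hyp⟩ := mem_midPrimes_tenth.mp hp
    rw [mem_primeWindow (Real.rpow_nonneg hX'0.le _), hwin0, hwin1]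
    refine ⟨hpprime, ?_, hyp.le⟩
    have : zT / Real.exp 1 < zT := div_lt_self hz0 he1
    linarith
  -- nonnegativity of the summands on the window
  have hu_le : ∀ p ∈ primeWindow (X' ^ s₀) (X' ^ sM), Real.log p / L' ≤ 1 / 3 ∧ 0 ≤ Real.log p / L' := by
    intro p hp
    obtain ⟨hpprime, hlo, hhi⟩ := (mem_primeWindow (Real.rpow_nonneg hX'0.le _)).mp hp
    have hp0 : (0 : ℝ) < p := by exact_mod_cast hpprime.pos
    have hp1 : (1 : ℝ) ≤ p := by exact_mod_cast hpprime.one_lt.le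
    constructor
    · rw [div_le_iff₀ hL'0]
      have := Real.log_le_log hp0 hhi
      rw [Real.log_rpow hX'0] at this
      nlinarith
    · exact div_nonneg (Real.log_nonneg hp1) hL'0.le
  -- split the sum
  have hsplit : ∑ p₁ ∈ midPrimes zT (y N), (p₁ : ℝ)⁻¹ * (phiFun (Real.log p₁ / L') + ρ) ≤
      ∑ p₁ ∈ primeWindow (X' ^ s₀) (X' ^ sM), (p₁ : ℝ)⁻¹ * phiFun (Real.log p₁ / L') +
        ρ * ∑ p₁ ∈ primeWindow (X' ^ s₀) (X' ^ sM), (p₁ : ℝ)⁻¹ := by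
    rw [Finset.mul_sum, ← Finset.sum_add_distrib]
    refine Finset.sum_le_sum_of_subset_of_nonneg hsub ?_ |>.trans (le_of_eq ?_)
    · intro p hp _
      have := (hu_le p hp)
      exact mul_nonneg (by positivity) (add_nonneg (phiFun_nonneg this.1) hρ)
    · exact Finset.sum_congr rfl fun p _ => by ring
  refine hsplit.trans ?_
  have houter := outer_sum_leT hX'1 hs₀10 hs₀8 hsM8 hsM3 hm hx2
  -- `∑_{z/e < p ≤ y} 1/p ≤ 3`
  have hmert : ∑ p₁ ∈ primeWindow (X' ^ s₀) (X' ^ sM), (p₁ : ℝ)⁻¹ ≤ 3 := by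
    rw [hwin0, hwin1]
    have hze : 2 ≤ zT / Real.exp 1 := by rw [le_div_iff₀ (Real.exp_pos 1)]; nlinarith
    have hzey : zT / Real.exp 1 ≤ y N := (div_lt_self hz0 he1).le.trans hzy
    refine (sum_inv_primeWindow_le hze hzey).trans ?_
    have hlogze : Real.log (zT / Real.exp 1) = L / 10 - 1 := by
      rw [Real.log_div hz0.ne' (Real.exp_pos 1).ne', Real.log_exp, hlogz]
    rw [hlogze, hlogy]
    have hden : 0 < L / 10 - 1 := by linarith
    have hratio : L / 3 / (L / 10 - 1) ≤ 4 := by rw [div_le_iff₀ hden]; linarith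
    have hlog3 : Real.log (L / 3 / (L / 10 - 1)) ≤ 2 := by
      have h1 : Real.log (L / 3 / (L / 10 - 1)) ≤ Real.log 4 :=
        Real.log_le_log (by positivity) hratio
      have h2 : Real.log (4 : ℝ) = 2 * Real.log 2 := by
        rw [show (4 : ℝ) = 2 ^ 2 by norm_num, Real.log_pow]; norm_num
      have h3 := Real.log_two_lt_d9
      norm_num at h3
      linarith
    have h16 : 16 / (L / 10 - 1) ≤ 1 := by rw [div_le_iff₀ hden]; linarith
    linarith
  have hs₀' : 25 * (1 / 10 - s₀) ≤ 50 / L' := by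
    rw [hs₀, hlogz, show (1 : ℝ) / 10 - (L / 10 - 1) / L' = (L' / 10 - (L / 10 - 1)) / L' by field_simp,
      mul_div_assoc', div_le_div_iff_of_pos_right hL'0]
    linarith
  have := mul_le_mul_of_nonneg_left hmert hρ
  linarith


set_option maxHeartbeats 800000 in
/-- **The cardinality of `B̃` at `z = N^{1/10}`** (Chen's (28): the double prime sum is
`≤ (1 + o(1)) c₁₀/log N`, `c₁₀ = ∫_{1/10}^{1/3} log(2−3β)/(β(1−β)) dβ`): for `0 < ε ≤ 1` and every `η > 0`, for all large `N`,
`#T̃(N, ε) ≤ (1+ε)² (c + η) N/log N`.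
The prime number theorem (upper bound, `exists_card_primesBelow_ceil_le`) counts `p₃`; the sums over
`p₂` and `p₁` are compared with the integrals through Mertens' theorem on the windows of a grid in
logarithmic scale (`inner_applied`, `outer_applied`), and the double integral is `c`
(`integral_phiFun_div_tenth`). [cite: ChenSciSinica1973, Lemma 8 eq. (27)–(28)] -/
theorem card_switchedTriplesT_le {ε : ℝ} (hε : 0 < ε) (hε1 : ε ≤ 1) {η : ℝ} (hη : 0 < η) :
    ∀ᶠ N : ℕ in atTop,
      (#(switchedTriplesT N ε) : ℝ) ≤ (1 + ε) ^ 2 * (switchingConstantTenth + η) * N / Real.log N := by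
  obtain ⟨x₀, hx₀⟩ := exists_card_primesBelow_ceil_le hε
  set x₁ : ℝ := max x₀ 3 with hx₁
  have hx₁3 : 3 ≤ x₁ := le_max_right _ _
  have hPNT : ∀ x : ℝ, x₁ ≤ x → (#(Nat.primesBelow ⌈x⌉₊) : ℝ) ≤ (1 + ε) * x / Real.log x :=
    fun x hx => hx₀ x (le_trans (le_max_left _ _) hx)
  -- the mesh
  set m : ℕ := ⌈196 / η⌉₊ + 1 with hmdef
  have hm1 : 1 ≤ m := by omega
  have hm0 : (0 : ℝ) < m := by exact_mod_cast hm1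
  have hmη : 49 / (m : ℝ) ≤ η / 4 := by
    have h1 : 196 / η ≤ m := by
      rw [hmdef]; push_cast
      exact (Nat.le_ceil _).trans (by linarith)
    rw [div_le_iff₀ hm0]
    rw [div_le_iff₀ hη] at h1
    linarith
  -- eventual conditions
  have hlog : Tendsto (fun N : ℕ => Real.log N) atTop atTop :=
    Real.tendsto_log_atTop.comp (tendsto_natCast_atTop_atTop (R := ℝ))
  have hcube : Tendsto (fun N : ℕ => ((N : ℝ)) ^ (1 / 3 : ℝ)) atTop atTop :=
    (tendsto_rpow_atTop (by norm_num : (0 : ℝ) < 1 / 3)).comp (tendsto_natCast_atTop_atTop (R := ℝ))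
  filter_upwards [eventually_ge_atTop (6 ^ 10), hlog.eventually_ge_atTop 180,
    hlog.eventually_ge_atTop (4 * 1266 * m / η), hcube.eventually_ge_atTop x₁] with N hN hL136 hLm hNx₁
  have hN2 : 2 ≤ N := le_trans (by norm_num) hN
  have hN0 : (0 : ℝ) < N := by exact_mod_cast (show 0 < N by omega)
  obtain ⟨hX'1, hLL', hL'L⟩ := log_enlarged_bounds hN2 hε hε1
  set X' : ℝ := (1 + ε) * N with hX'
  set L' : ℝ := Real.log X' with hL'def
  set L : ℝ := Real.log N with hLdef
  have hL0 : 0 < L := by linarith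
  have hL'0 : 0 < L' := by linarith
  have hL15 : 15 ≤ L := by linarith
  -- Step 1: PNT
  have h1 := card_le_pnt_sumT hN2 hε hx₁3 hPNT hNx₁ hε.le
  rw [← hX', ← hL'def] at h1
  -- Step 2: the inner sums
  set ρ : ℝ := 8 / m + 272 * m / L' with hρ
  have hρ0 : 0 ≤ ρ := by positivity
  have h2 : ∑ p₁ ∈ midPrimes ((N : ℝ) ^ (1 / 10 : ℝ)) (y N), (p₁ : ℝ)⁻¹ * ∑ p₂ ∈ secondPrimes N ε p₁,
      (p₂ : ℝ)⁻¹ * (1 / ((1 - Real.log p₁ / L') - Real.log p₂ / L')) ≤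
      ∑ p₁ ∈ midPrimes ((N : ℝ) ^ (1 / 10 : ℝ)) (y N), (p₁ : ℝ)⁻¹ * (phiFun (Real.log p₁ / L') + ρ) := by
    refine Finset.sum_le_sum fun p₁ hp₁ => mul_le_mul_of_nonneg_left ?_ (by positivity)
    have := inner_appliedT hN hε hε1 hL15 hm1 hp₁
    rw [hρ]; linarith
  -- Step 3: the outer sum
  have h3 := outer_appliedT hN hε hε1 hL136 hm1 hρ0
  -- assemble
  have hfac0 : 0 ≤ (1 + ε) * (X' / L') := by positivity
  have hB : switchingConstantTenth + 50 / L' + 25 / m + 400 * m / L' + 3 * ρ ≤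
      switchingConstantTenth + η / 2 := by
    have hm1' : (1 : ℝ) ≤ m := by exact_mod_cast hm1
    -- `49/m ≤ η/4` and `1266 m/L' ≤ η/4`
    have hLm' : 4 * 1266 * m / η ≤ L' := hLm.trans hLL'
    have hsecond : 1266 * m / L' ≤ η / 4 := by
      rw [div_le_iff₀ hL'0]
      rw [div_le_iff₀ hη] at hLm'
      nlinarith
    have e1 : 50 / L' + 400 * m / L' + 3 * (272 * m / L') ≤ 1266 * m / L' := by
      rw [show 50 / L' + 400 * m / L' + 3 * (272 * m / L') = (50 + 1216 * m) / L' by ring]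
      exact div_le_div_of_nonneg_right (by linarith) hL'0.le
    have e2 : 25 / (m : ℝ) + 3 * (8 / m) = 49 / m := by ring
    rw [hρ]
    nlinarith [e1, e2, hmη, hsecond]
  have hXL : X' / L' ≤ (1 + ε) * N / L := by
    rw [div_le_div_iff₀ hL'0 hL0, hX']
    have : 0 ≤ (1 + ε) * (N : ℝ) := by positivity
    nlinarith
  calc (#(switchedTriplesT N ε) : ℝ)
      ≤ (1 + ε) * (X' / L') * ∑ p₁ ∈ midPrimes ((N : ℝ) ^ (1 / 10 : ℝ)) (y N), (p₁ : ℝ)⁻¹ * ∑ p₂ ∈ secondPrimes N ε p₁,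
          (p₂ : ℝ)⁻¹ * (1 / ((1 - Real.log p₁ / L') - Real.log p₂ / L')) := h1
    _ ≤ (1 + ε) * (X' / L') * ∑ p₁ ∈ midPrimes ((N : ℝ) ^ (1 / 10 : ℝ)) (y N), (p₁ : ℝ)⁻¹ * (phiFun (Real.log p₁ / L') + ρ) :=
        mul_le_mul_of_nonneg_left h2 hfac0
    _ ≤ (1 + ε) * (X' / L') * (switchingConstantTenth + η / 2) :=
        mul_le_mul_of_nonneg_left (h3.trans hB) hfac0
    _ ≤ (1 + ε) * ((1 + ε) * N / L) * (switchingConstantTenth + η / 2) := by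
        have hc0 : 0 ≤ switchingConstantTenth + η / 2 := by
          have := switchingConstantTenth_nonneg; positivity
        exact mul_le_mul_of_nonneg_right (mul_le_mul_of_nonneg_left hXL (by linarith)) hc0
    _ ≤ (1 + ε) ^ 2 * (switchingConstantTenth + η) * N / L := by
        rw [show (1 + ε) * ((1 + ε) * N / L) * (switchingConstantTenth + η / 2) =
          ((1 + ε) ^ 2 * (switchingConstantTenth + η / 2) * N) / L by ring]
        refine div_le_div_of_nonneg_right ?_ hL0.le
        have : 0 ≤ (1 + ε) ^ 2 * (N : ℝ) := by positivity
        nlinarith [switchingConstantTenth_nonneg]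


end Literature.NumberTheory.Sieve.Chen
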